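import Summits.QuantumFields.YangMills.Theorems.SwapVirialDeficitZeroModeGroupFourSmallBallLogPrelim
import HarnessLib

/-!
# The LOG-SQUEEZE LEMMA of the periodic massive-mode rung: `∫dσ(x) ∫₀^∞ K_t(x, ρ) dρ / log(1/t) → ½·∫g dσ` from a two-scale structure
# (abstract form of w3 g63's part XII ✓`ZeroModeGroup.tendsto_Irad_div_log`; free-hands support of ⟨stmt-QuantumFields-24196⟩ `SwapVirialDeficit.ToronSoftnessSharp`)

The `log(1/t)` of the periodic small-ball laws (zero-mode block ✓`ZeroModeGroup.tendsto_haar_nearlyCommuting_div_log`; target of the periodic rung =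
hypothesis `hlim` of ✓`PeriodicRing.tendsto_periodicMeanAction_of_principalLogLimit`) comes from ONE mechanism: after the exact scaling (✓PJ2
`lintegral_haar_four_eq_periodicLeaderChart` × ✓J1), the hub integral `∫ K_t(x, ρ) dρ` over the hub's transverse radius `ρ` has an integrand `≈ g(x)/ρ`
on the MIDDLE REGION `A√t < ρ ≤ δ` (two-scale limit), is `O(1)` on the DEEP region `ρ ≤ A√t` and on the OUTER region `ρ > δ`; hence
`∫ ≈ g(x)·log(δ/(A√t)) = g(x)·(log(δ/A) + ½log(1/t))`.  fcl-p3 g44's parts X–XI and w3 g63's XII did this for `N₄(t)` concretely (≈ 800 lines).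
This file does the ε-bookkeeping ONCE, abstractly, for a measurable kernel `K : ℝ → X × ℝ → ℝ≥0∞` on a measurable space `X` with a measure `σ`:
* §1 `lintegral_Ioi_split` (`(0,∞) = (0,a] ∪ (a,δ] ∪ (δ,∞)`), `lintegral_middle_weight` (`∫_{(a,δ]} G·ρ⁻¹ = G·log(δ/a)`, ✓`lintegral_inv_Ioc`);
* §2 ★★ `lintegral_hub_le_of_twoScale` — the UPPER two-scale bound `I(t) ≤ C_A + C_δ + (∫G dσ)·log(δ/(A√t))` eventually, and `I(t) < ∞`;
* §3 ★★ `eventually_div_log_lt_of_twoScale` (upper half) and ★★ `eventually_lt_div_log_of_twoScale` (lower half);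
* §4 ★★★ `tendsto_div_log_of_twoScale` — HYPOTHESES: (deep) `∀ A>0 ∃ C<∞ ∀ᶠt, ∫dσ∫_{(0,A√t]} K_t ≤ C`; (outer) `∀ δ>0 ∃ C<∞ ∀ᶠt, ∫dσ∫_{(δ,∞)} K_t ≤ C`;
  (upper) `∀ ε>0 ∃ A δ G, ∫G dσ ≤ gI + ε ∧ ∀ᶠt ∀x ∀ρ ∈ (A√t, δ], K_t(x,ρ) ≤ G(x)/ρ`; (lower) `∀ ε>0 ∃ A δ G, gI − ε ≤ ∫G dσ ∧ ∀ᶠt ∀x ∀ρ ∈ (A√t, δ],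
  G(x)/ρ ≤ K_t(x,ρ)`; CONCLUSION `(∫dσ ∫_{(0,∞)} K_t).toReal / log(1/t) → gI/2` as `t → 0⁺`.
  In XII: `X = ℝ ∋ a₀` (Lebesgue), `K_t(a₀, ρ) = radK t a₀ ρ`, `G_ε(a₀) = 𝟙{a₀²<1}·(a₀²+δ²)^{3/2}/64·(h₀+ε′)` off `|a₀| ≤ r₀`, `gI = h₀/128`
  (✓`lintegral_radK_deep_le`, ✓`lintegral_radK_outer_le`, ✓`Irad_le`/✓`le_Irad`); in the periodic rung the same with the joint fibre measure of leaders ×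
  followers in place of `V_t`.
Deliberately NOT here: any geometry (two-scale sets, dominators, fibre limits).
HONEST LABEL: one-variable real analysis (plumbing for a plan-level fixed-`L` rung of a DRAFT line); NOT ⟨24196⟩/⟨24497⟩; own crux ⟨22884⟩ OPEN (blocked-on
⟨19935⟩); the Yang–Mills mass gap is NOT proved; no summit is proved by a line.
Width seat ym-line-sfw-p2-w3 g64 (cell ym-idea-1, free hands), `--supports stmt-QuantumFields-24196`.  THEOREMS ONLY (0 `def`, 0 `sorry`), standard axioms.
References: [cite: Luscher1983, §2]; [cite: GonzalezarroyoAltes1988]; [folklore].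
-/

set_option autoImplicit false

noncomputable section

open MeasureTheory Set Filter Topology
open scoped ENNReal

namespace Summit.QuantumFields.YangMills.Theorems.SwapVirialDeficit.BlowUp

open Summit.QuantumFields.YangMills.Theorems.SwapVirialDeficit.ZeroModeGroup (lintegral_inv_Ioc eventually_pos_lt mul_sqrt_le log_div_mul_sqrt)

variable {X : Type*} [MeasurableSpace X]

/-! ## §1 Splitting the hub radius and the middle weight -/

/-- `∫_{(0,∞)} f = ∫_{(0,a]} f + ∫_{(a,δ]} f + ∫_{(δ,∞)} f` (`0 ≤ a ≤ δ`; any `f ≥ 0`). [folklore] -/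
theorem lintegral_Ioi_split (f : ℝ → ℝ≥0∞) {a δ : ℝ} (ha : 0 ≤ a) (haδ : a ≤ δ) :
    ∫⁻ ρ in Ioi 0, f ρ = (∫⁻ ρ in Ioc 0 a, f ρ) + (∫⁻ ρ in Ioc a δ, f ρ) + ∫⁻ ρ in Ioi δ, f ρ := by
  rw [← Set.Ioc_union_Ioi_eq_Ioi ha, lintegral_union measurableSet_Ioi Set.Ioc_disjoint_Ioi_same, ← Set.Ioc_union_Ioi_eq_Ioi haδ,
    lintegral_union measurableSet_Ioi Set.Ioc_disjoint_Ioi_same, add_assoc]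

/-- `∫_{(a,δ]} c·ρ⁻¹ dρ = c·log(δ/a)` (`0 < a ≤ δ`; ✓`lintegral_inv_Ioc`). [folklore] -/
theorem lintegral_middle_weight (c : ℝ≥0∞) {a δ : ℝ} (ha : 0 < a) (haδ : a ≤ δ) :
    ∫⁻ ρ in Ioc a δ, c * ENNReal.ofReal ρ⁻¹ = c * ENNReal.ofReal (Real.log (δ / a)) := by
  have hm : Measurable fun ρ : ℝ => ENNReal.ofReal ρ⁻¹ := ENNReal.measurable_ofReal.comp measurable_inv
  rw [lintegral_const_mul _ hm, lintegral_inv_Ioc ha haδ]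

/-- Measurability of a restricted hub section `x ↦ ∫_{S} K_t(x, ρ) dρ` for a jointly measurable kernel. [folklore] -/
theorem measurable_lintegral_section {K : X × ℝ → ℝ≥0∞} (hK : Measurable K) (S : Set ℝ) :
    Measurable fun x : X => ∫⁻ ρ in S, K (x, ρ) :=
  hK.lintegral_prod_right' (ν := (volume : Measure ℝ).restrict S)

/-- `log(δ/A) ≤ 0 ≤ log(δ/(A√t)) ≤ log(1/t)/2` for `0 < t ≤ (δ/A)²`, `0 < δ ≤ 1 ≤ A`. [folklore] -/
theorem log_middle_bounds {A δ t : ℝ} (hA1 : 1 ≤ A) (hδ : 0 < δ) (hδ1 : δ ≤ 1) (ht : 0 < t) (htδ : t ≤ (δ / A) ^ 2) :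
    Real.log (δ / A) ≤ 0 ∧ 0 ≤ Real.log (δ / (A * Real.sqrt t)) ∧ Real.log (δ / (A * Real.sqrt t)) ≤ Real.log (1 / t) / 2 := by
  have hA : 0 < A := by linarith
  have h1 : Real.log (δ / A) ≤ 0 := Real.log_nonpos (by positivity) (by rw [div_le_one hA]; linarith)
  have ha : A * Real.sqrt t ≤ δ := mul_sqrt_le hA hδ.le htδ
  have hapos : 0 < A * Real.sqrt t := mul_pos hA (Real.sqrt_pos.2 ht)
  refine ⟨h1, Real.log_nonneg (by rw [le_div_iff₀ hapos]; linarith), ?_⟩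
  rw [log_div_mul_sqrt hA hδ ht]; linarith

/-! ## §2 The upper two-scale bound -/

/-- ★★ **UPPER TWO-SCALE BOUND**: with a deep constant `C₁` (region `ρ ≤ A√t`), an outer constant `C₂` (region `ρ > δ`) and a middle majorant
`K_t(x,ρ) ≤ G(x)/ρ` on `A√t < ρ ≤ δ`, for every admissible `t`:
`∫dσ ∫_{(0,∞)} K_t ≤ C₁ + C₂ + (∫G dσ)·log(δ/(A√t))`. [folklore] -/
theorem lintegral_hub_le_of_twoScale (σ : Measure X) {K : X × ℝ → ℝ≥0∞} (hK : Measurable K) {A δ t : ℝ} (hA : 0 < A) (ht : 0 < t)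
    (haδ : A * Real.sqrt t ≤ δ) {C₁ C₂ : ℝ≥0∞} (G : X → ℝ≥0∞)
    (hdeep : ∫⁻ x, (∫⁻ ρ in Ioc 0 (A * Real.sqrt t), K (x, ρ)) ∂σ ≤ C₁) (houter : ∫⁻ x, (∫⁻ ρ in Ioi δ, K (x, ρ)) ∂σ ≤ C₂)
    (hmid : ∀ x, ∀ ρ ∈ Ioc (A * Real.sqrt t) δ, K (x, ρ) ≤ G x * ENNReal.ofReal ρ⁻¹) :
    ∫⁻ x, (∫⁻ ρ in Ioi 0, K (x, ρ)) ∂σ ≤ C₁ + C₂ + (∫⁻ x, G x ∂σ) * ENNReal.ofReal (Real.log (δ / (A * Real.sqrt t))) := by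
  have hapos : 0 < A * Real.sqrt t := mul_pos hA (Real.sqrt_pos.2 ht)
  have hsplit : ∀ x, ∫⁻ ρ in Ioi 0, K (x, ρ) =
      (∫⁻ ρ in Ioc 0 (A * Real.sqrt t), K (x, ρ)) + (∫⁻ ρ in Ioc (A * Real.sqrt t) δ, K (x, ρ)) + ∫⁻ ρ in Ioi δ, K (x, ρ) :=
    fun x => lintegral_Ioi_split (fun ρ => K (x, ρ)) hapos.le haδ
  simp only [hsplit]
  have hm1 := measurable_lintegral_section hK (Ioc 0 (A * Real.sqrt t))
  have hm2 := measurable_lintegral_section hK (Ioc (A * Real.sqrt t) δ)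
  rw [lintegral_add_right _ (measurable_lintegral_section hK (Ioi δ)), lintegral_add_left hm1]
  -- the middle region
  have hmidI : ∫⁻ x, (∫⁻ ρ in Ioc (A * Real.sqrt t) δ, K (x, ρ)) ∂σ ≤ (∫⁻ x, G x ∂σ) * ENNReal.ofReal (Real.log (δ / (A * Real.sqrt t))) := by
    rw [← lintegral_mul_const' _ _ ENNReal.ofReal_ne_top]
    refine lintegral_mono fun x => ?_
    rw [← lintegral_middle_weight (G x) hapos haδ]
    refine lintegral_mono_ae ?_
    filter_upwards [ae_restrict_mem measurableSet_Ioc] with ρ hρ using hmid x ρ hρ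
  calc ∫⁻ x, (∫⁻ ρ in Ioc 0 (A * Real.sqrt t), K (x, ρ)) ∂σ + ∫⁻ x, (∫⁻ ρ in Ioc (A * Real.sqrt t) δ, K (x, ρ)) ∂σ + ∫⁻ x, (∫⁻ ρ in Ioi δ, K (x, ρ)) ∂σ
      ≤ C₁ + (∫⁻ x, G x ∂σ) * ENNReal.ofReal (Real.log (δ / (A * Real.sqrt t))) + C₂ := add_le_add (add_le_add hdeep hmidI) houter
    _ = C₁ + C₂ + (∫⁻ x, G x ∂σ) * ENNReal.ofReal (Real.log (δ / (A * Real.sqrt t))) := add_right_comm _ _ _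

/-- ★ **LOWER TWO-SCALE BOUND**: with a middle minorant `G(x)/ρ ≤ K_t(x,ρ)` on `A√t < ρ ≤ δ`,
`(∫G dσ)·log(δ/(A√t)) ≤ ∫dσ ∫_{(0,∞)} K_t`. [folklore] -/
theorem le_lintegral_hub_of_twoScale (σ : Measure X) (K : X × ℝ → ℝ≥0∞) {A δ t : ℝ} (hA : 0 < A) (ht : 0 < t) (haδ : A * Real.sqrt t ≤ δ)
    (G : X → ℝ≥0∞) (hmid : ∀ x, ∀ ρ ∈ Ioc (A * Real.sqrt t) δ, G x * ENNReal.ofReal ρ⁻¹ ≤ K (x, ρ)) :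
    (∫⁻ x, G x ∂σ) * ENNReal.ofReal (Real.log (δ / (A * Real.sqrt t))) ≤ ∫⁻ x, (∫⁻ ρ in Ioi 0, K (x, ρ)) ∂σ := by
  have hapos : 0 < A * Real.sqrt t := mul_pos hA (Real.sqrt_pos.2 ht)
  rw [← lintegral_mul_const' _ _ ENNReal.ofReal_ne_top]
  refine lintegral_mono fun x => ?_
  rw [← lintegral_middle_weight (G x) hapos haδ]
  calc ∫⁻ ρ in Ioc (A * Real.sqrt t) δ, G x * ENNReal.ofReal ρ⁻¹
      ≤ ∫⁻ ρ in Ioc (A * Real.sqrt t) δ, K (x, ρ) := by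
        refine lintegral_mono_ae ?_
        filter_upwards [ae_restrict_mem measurableSet_Ioc] with ρ hρ using hmid x ρ hρ
    _ ≤ ∫⁻ ρ in Ioi 0, K (x, ρ) := lintegral_mono_set fun ρ hρ => hapos.trans hρ.1

/-! ## §3 The two halves of the squeeze -/

/-- `log(1/t) → +∞` as `t → 0⁺`, and eventually `C < c·log(1/t)` for `c > 0`. [folklore] -/
theorem eventually_lt_mul_log {C c : ℝ} (hc : 0 < c) : ∀ᶠ t in 𝓝[>] (0 : ℝ), C < c * Real.log (1 / t) := by
  have h1 : Tendsto (fun t : ℝ => Real.log (1 / t)) (𝓝[>] (0 : ℝ)) atTop := by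
    have h := Real.tendsto_log_atTop.comp tendsto_inv_nhdsGT_zero
    refine h.congr fun t => ?_
    simp only [Function.comp_apply, one_div]
  exact (h1.const_mul_atTop hc).eventually_gt_atTop C

/-- ★★ **UPPER HALF**: under (deep), (outer), (upper) and `gI ≥ 0`, for every `b > gI/2`, eventually `(∫dσ∫ K_t).toReal / log(1/t) < b`. [folklore] -/
theorem eventually_div_log_lt_of_twoScale (σ : Measure X) {K : ℝ → X × ℝ → ℝ≥0∞} (hK : ∀ t, Measurable (K t)) {gI : ℝ} (hgI : 0 ≤ gI)
    (hdeep : ∀ A : ℝ, 0 < A → ∃ C : ℝ≥0∞, C ≠ ∞ ∧ ∀ᶠ t in 𝓝[>] (0 : ℝ), ∫⁻ x, (∫⁻ ρ in Ioc 0 (A * Real.sqrt t), K t (x, ρ)) ∂σ ≤ C)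
    (houter : ∀ δ : ℝ, 0 < δ → ∃ C : ℝ≥0∞, C ≠ ∞ ∧ ∀ᶠ t in 𝓝[>] (0 : ℝ), ∫⁻ x, (∫⁻ ρ in Ioi δ, K t (x, ρ)) ∂σ ≤ C)
    (hupper : ∀ ε : ℝ, 0 < ε → ∃ A δ : ℝ, 0 < A ∧ 0 < δ ∧ ∃ G : X → ℝ≥0∞, ∫⁻ x, G x ∂σ ≤ ENNReal.ofReal (gI + ε) ∧
      ∀ᶠ t in 𝓝[>] (0 : ℝ), ∀ x, ∀ ρ ∈ Ioc (A * Real.sqrt t) δ, K t (x, ρ) ≤ G x * ENNReal.ofReal ρ⁻¹)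
    {b : ℝ} (hb : gI / 2 < b) :
    ∀ᶠ t in 𝓝[>] (0 : ℝ), (∫⁻ x, (∫⁻ ρ in Ioi 0, K t (x, ρ)) ∂σ).toReal / Real.log (1 / t) < b := by
  -- gap and the middle tolerance
  obtain ⟨gap, hgap⟩ : ∃ gap : ℝ, gap = b - gI / 2 := ⟨_, rfl⟩
  have hgap0 : 0 < gap := by rw [hgap]; linarith
  obtain ⟨A₀, δ₀, hA₀, hδ₀, G, hG, hmid⟩ := hupper (gap / 2) (by positivity)
  -- normalise: `A ≥ 1`, `δ ≤ 1` (the middle bound survives on the smaller region)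
  set A : ℝ := max A₀ 1 with hAd
  set δ : ℝ := min δ₀ 1 with hδd
  have hA1 : 1 ≤ A := le_max_right _ _
  have hA : 0 < A := by linarith
  have hδ : 0 < δ := lt_min hδ₀ one_pos
  have hδ1 : δ ≤ 1 := min_le_right _ _
  obtain ⟨C₁, hC₁, hdeep'⟩ := hdeep A hA
  obtain ⟨C₂, hC₂, houter'⟩ := houter δ hδ
  have hGfin : ∫⁻ x, G x ∂σ ≠ ∞ := ne_top_of_le_ne_top ENNReal.ofReal_ne_top hG
  -- the `t`-independent constant
  obtain ⟨K₀, hK₀⟩ : ∃ K₀ : ℝ, K₀ = (C₁ + C₂).toReal := ⟨_, rfl⟩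
  have hK₀0 : 0 ≤ K₀ := by rw [hK₀]; exact ENNReal.toReal_nonneg
  filter_upwards [hmid, hdeep', houter', eventually_pos_lt (show (0 : ℝ) < min ((δ / A) ^ 2) (1 / 2) by positivity),
    eventually_lt_mul_log (C := K₀) (half_pos hgap0)] with t hmid_t hdeep_t houter_t ht hKlog
  obtain ⟨ht0, htt⟩ := ht
  have htδ : t ≤ (δ / A) ^ 2 := (lt_of_lt_of_le htt (min_le_left _ _)).le
  have haδ : A * Real.sqrt t ≤ δ := mul_sqrt_le hA hδ.le htδ
  obtain ⟨hlogA, hlog0, hlogL⟩ := log_middle_bounds hA1 hδ hδ1 ht0 htδ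
  have hℓ : 0 < Real.log (1 / t) := Real.log_pos (by rw [lt_div_iff₀ ht0]; linarith [lt_of_lt_of_le htt (min_le_right _ _)])
  -- the middle bound on the smaller region `(A√t, δ] ⊆ (A₀√t, δ₀]`
  have hmid' : ∀ x, ∀ ρ ∈ Ioc (A * Real.sqrt t) δ, K t (x, ρ) ≤ G x * ENNReal.ofReal ρ⁻¹ := by
    intro x ρ hρ
    refine hmid_t x ρ ⟨lt_of_le_of_lt ?_ hρ.1, hρ.2.trans (min_le_left _ _)⟩
    exact mul_le_mul_of_nonneg_right (le_max_left _ _) (Real.sqrt_nonneg _)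
  have hI := lintegral_hub_le_of_twoScale σ (hK t) hA ht0 haδ G hdeep_t houter_t hmid'
  -- pass to reals
  set L : ℝ := Real.log (δ / (A * Real.sqrt t)) with hLd
  have hRHS : C₁ + C₂ + (∫⁻ x, G x ∂σ) * ENNReal.ofReal L ≤ ENNReal.ofReal (K₀ + (gI + gap / 2) * L) := by
    have h1 : C₁ + C₂ = ENNReal.ofReal K₀ := by rw [hK₀, ENNReal.ofReal_toReal (ENNReal.add_ne_top.2 ⟨hC₁, hC₂⟩)]
    have h2 : (∫⁻ x, G x ∂σ) * ENNReal.ofReal L ≤ ENNReal.ofReal ((gI + gap / 2) * L) := by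
      rw [ENNReal.ofReal_mul (by positivity)]
      exact mul_le_mul' hG le_rfl
    calc C₁ + C₂ + (∫⁻ x, G x ∂σ) * ENNReal.ofReal L ≤ ENNReal.ofReal K₀ + ENNReal.ofReal ((gI + gap / 2) * L) := by
          rw [h1]; exact add_le_add le_rfl h2
      _ = ENNReal.ofReal (K₀ + (gI + gap / 2) * L) := by rw [← ENNReal.ofReal_add hK₀0 (by positivity)]
  have hIreal : (∫⁻ x, (∫⁻ ρ in Ioi 0, K t (x, ρ)) ∂σ).toReal ≤ K₀ + (gI + gap / 2) * L :=
    ENNReal.toReal_le_of_le_ofReal (by positivity) (hI.trans hRHS)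
  -- bookkeeping: `I ≤ K₀ + (gI + gap/2)·log(1/t)/2`, `K₀ < (gap/2)·log(1/t)`
  rw [div_lt_iff₀ hℓ]
  have h3 : (gI + gap / 2) * L ≤ (gI + gap / 2) * (Real.log (1 / t) / 2) := mul_le_mul_of_nonneg_left hlogL (by positivity)
  have h4 : b * Real.log (1 / t) = (gI / 2 + gap) * Real.log (1 / t) := by rw [hgap]; ring
  rw [h4]
  nlinarith [hIreal, h3, hKlog, hℓ, hgap0]

/-- ★★ **LOWER HALF**: under (lower), finiteness of the hub integral for small `t`, and `b < gI/2`, eventually `b < (∫dσ∫ K_t).toReal / log(1/t)`. [folklore] -/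
theorem eventually_lt_div_log_of_twoScale (σ : Measure X) (K : ℝ → X × ℝ → ℝ≥0∞) {gI : ℝ}
    (hfin : ∀ᶠ t in 𝓝[>] (0 : ℝ), ∫⁻ x, (∫⁻ ρ in Ioi 0, K t (x, ρ)) ∂σ ≠ ∞)
    (hlower : ∀ ε : ℝ, 0 < ε → ∃ A δ : ℝ, 0 < A ∧ 0 < δ ∧ ∃ G : X → ℝ≥0∞, ENNReal.ofReal (gI - ε) ≤ ∫⁻ x, G x ∂σ ∧
      ∀ᶠ t in 𝓝[>] (0 : ℝ), ∀ x, ∀ ρ ∈ Ioc (A * Real.sqrt t) δ, G x * ENNReal.ofReal ρ⁻¹ ≤ K t (x, ρ))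
    {b : ℝ} (hb : b < gI / 2) :
    ∀ᶠ t in 𝓝[>] (0 : ℝ), b < (∫⁻ x, (∫⁻ ρ in Ioi 0, K t (x, ρ)) ∂σ).toReal / Real.log (1 / t) := by
  obtain ⟨gap, hgap⟩ : ∃ gap : ℝ, gap = gI / 2 - b := ⟨_, rfl⟩
  have hgap0 : 0 < gap := by rw [hgap]; linarith
  obtain ⟨A₀, δ₀, hA₀, hδ₀, G, hG, hmid⟩ := hlower (gap / 2) (by positivity)
  set A : ℝ := max A₀ 1 with hAd
  set δ : ℝ := min δ₀ 1 with hδd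
  have hA1 : 1 ≤ A := le_max_right _ _
  have hA : 0 < A := by linarith
  have hδ : 0 < δ := lt_min hδ₀ one_pos
  have hδ1 : δ ≤ 1 := min_le_right _ _
  -- the coefficient `m = gI − gap/2` and the `t`-independent constant `m·|log(δ/A)|`
  obtain ⟨m, hm⟩ : ∃ m : ℝ, m = gI - gap / 2 := ⟨_, rfl⟩
  filter_upwards [hmid, hfin, eventually_pos_lt (show (0 : ℝ) < min ((δ / A) ^ 2) (1 / 2) by positivity),
    eventually_lt_mul_log (C := |m| * |Real.log (δ / A)|) (half_pos hgap0)] with t hmid_t hfin_t ht hKlog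
  obtain ⟨ht0, htt⟩ := ht
  have htδ : t ≤ (δ / A) ^ 2 := (lt_of_lt_of_le htt (min_le_left _ _)).le
  have haδ : A * Real.sqrt t ≤ δ := mul_sqrt_le hA hδ.le htδ
  obtain ⟨hlogA, hlog0, -⟩ := log_middle_bounds hA1 hδ hδ1 ht0 htδ
  have hℓ : 0 < Real.log (1 / t) := Real.log_pos (by rw [lt_div_iff₀ ht0]; linarith [lt_of_lt_of_le htt (min_le_right _ _)])
  rw [lt_div_iff₀ hℓ]
  by_cases hmneg : m < 0
  · -- then `b < 0 ≤ I/L`: `m < 0 ⟺ gI < gap/2`, and `b = gI/2 − gap < 0`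
    have hb0 : b < 0 := by rw [hm] at hmneg; nlinarith [hgap]
    have : 0 ≤ (∫⁻ x, (∫⁻ ρ in Ioi 0, K t (x, ρ)) ∂σ).toReal := ENNReal.toReal_nonneg
    nlinarith
  · have hm0 : 0 ≤ m := not_lt.1 hmneg
    -- the middle bound on the smaller region
    have hmid' : ∀ x, ∀ ρ ∈ Ioc (A * Real.sqrt t) δ, G x * ENNReal.ofReal ρ⁻¹ ≤ K t (x, ρ) := by
      intro x ρ hρ
      refine hmid_t x ρ ⟨lt_of_le_of_lt ?_ hρ.1, hρ.2.trans (min_le_left _ _)⟩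
      exact mul_le_mul_of_nonneg_right (le_max_left _ _) (Real.sqrt_nonneg _)
    have hI := le_lintegral_hub_of_twoScale σ (K t) hA ht0 haδ G hmid'
    set L : ℝ := Real.log (δ / (A * Real.sqrt t)) with hLd
    have hLHS : ENNReal.ofReal (m * L) ≤ (∫⁻ x, G x ∂σ) * ENNReal.ofReal L := by
      rw [ENNReal.ofReal_mul hm0, hm]
      exact mul_le_mul' hG le_rfl
    have hIreal : m * L ≤ (∫⁻ x, (∫⁻ ρ in Ioi 0, K t (x, ρ)) ∂σ).toReal :=
      (ENNReal.ofReal_le_iff_le_toReal hfin_t).1 (hLHS.trans hI)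
    -- bookkeeping: `L = log(δ/A) + log(1/t)/2`, `log(δ/A) ≥ −|log(δ/A)|`, `m/2 − gap/2 − b = gap/4`
    have hLeq : L = Real.log (δ / A) + Real.log (1 / t) / 2 := by rw [hLd]; exact log_div_mul_sqrt hA hδ ht0
    have h5 : -( |m| * |Real.log (δ / A)| ) ≤ m * Real.log (δ / A) := by
      rw [abs_of_nonneg hm0]; nlinarith [neg_abs_le (Real.log (δ / A)), hm0]
    have step1 : m * Real.log (δ / A) + m * (Real.log (1 / t) / 2) ≤ (∫⁻ x, (∫⁻ ρ in Ioi 0, K t (x, ρ)) ∂σ).toReal := by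
      rw [hLeq, mul_add] at hIreal; exact hIreal
    have step2 : -(gap / 2 * Real.log (1 / t)) < m * Real.log (δ / A) := by linarith [h5, hKlog]
    have hcoef : b = m / 2 - gap / 2 - gap / 4 := by rw [hm, hgap]; ring
    rw [hcoef]
    nlinarith [step1, step2, hℓ, hgap0, mul_pos hgap0 hℓ]

/-! ## §4 The limit -/

/-- ★★★ **THE LOG-SQUEEZE LEMMA** (abstract part XII).  Let `K_t : X × ℝ → [0,∞]` be measurable for each `t`, `σ` a measure on `X`, `gI ≥ 0`, with
(deep) `∀ A > 0, ∃ C < ∞, ∀ᶠ t → 0⁺, ∫dσ ∫_{(0, A√t]} K_t ≤ C`; (outer) `∀ δ > 0, ∃ C < ∞, ∀ᶠ t, ∫dσ ∫_{(δ,∞)} K_t ≤ C`;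
(upper) `∀ ε > 0, ∃ A, δ > 0, G` with `∫G dσ ≤ gI + ε` and `∀ᶠ t, K_t(x, ρ) ≤ G(x)/ρ` on `A√t < ρ ≤ δ`;
(lower) `∀ ε > 0, ∃ A, δ > 0, G` with `gI − ε ≤ ∫G dσ` and `∀ᶠ t, G(x)/ρ ≤ K_t(x, ρ)` on `A√t < ρ ≤ δ`.
Then `(∫dσ ∫_{(0,∞)} K_t).toReal / log(1/t) → gI/2` as `t → 0⁺` — the middle region carries `(∫G)·(log(δ/A) + ½log(1/t))`, the rest is `O(1)`.
[folklore] -/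
theorem tendsto_div_log_of_twoScale (σ : Measure X) {K : ℝ → X × ℝ → ℝ≥0∞} (hK : ∀ t, Measurable (K t)) {gI : ℝ} (hgI : 0 ≤ gI)
    (hdeep : ∀ A : ℝ, 0 < A → ∃ C : ℝ≥0∞, C ≠ ∞ ∧ ∀ᶠ t in 𝓝[>] (0 : ℝ), ∫⁻ x, (∫⁻ ρ in Ioc 0 (A * Real.sqrt t), K t (x, ρ)) ∂σ ≤ C)
    (houter : ∀ δ : ℝ, 0 < δ → ∃ C : ℝ≥0∞, C ≠ ∞ ∧ ∀ᶠ t in 𝓝[>] (0 : ℝ), ∫⁻ x, (∫⁻ ρ in Ioi δ, K t (x, ρ)) ∂σ ≤ C)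
    (hupper : ∀ ε : ℝ, 0 < ε → ∃ A δ : ℝ, 0 < A ∧ 0 < δ ∧ ∃ G : X → ℝ≥0∞, ∫⁻ x, G x ∂σ ≤ ENNReal.ofReal (gI + ε) ∧
      ∀ᶠ t in 𝓝[>] (0 : ℝ), ∀ x, ∀ ρ ∈ Ioc (A * Real.sqrt t) δ, K t (x, ρ) ≤ G x * ENNReal.ofReal ρ⁻¹)
    (hlower : ∀ ε : ℝ, 0 < ε → ∃ A δ : ℝ, 0 < A ∧ 0 < δ ∧ ∃ G : X → ℝ≥0∞, ENNReal.ofReal (gI - ε) ≤ ∫⁻ x, G x ∂σ ∧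
      ∀ᶠ t in 𝓝[>] (0 : ℝ), ∀ x, ∀ ρ ∈ Ioc (A * Real.sqrt t) δ, G x * ENNReal.ofReal ρ⁻¹ ≤ K t (x, ρ)) :
    Tendsto (fun t : ℝ => (∫⁻ x, (∫⁻ ρ in Ioi 0, K t (x, ρ)) ∂σ).toReal / Real.log (1 / t)) (𝓝[>] (0 : ℝ)) (𝓝 (gI / 2)) := by
  -- finiteness for small `t` from the upper data (any tolerance, say `ε = 1`)
  have hfin : ∀ᶠ t in 𝓝[>] (0 : ℝ), ∫⁻ x, (∫⁻ ρ in Ioi 0, K t (x, ρ)) ∂σ ≠ ∞ := by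
    obtain ⟨A, δ, hA, hδ, G, hG, hmid⟩ := hupper 1 one_pos
    obtain ⟨C₁, hC₁, hdeep'⟩ := hdeep A hA
    obtain ⟨C₂, hC₂, houter'⟩ := houter δ hδ
    have hGfin : ∫⁻ x, G x ∂σ ≠ ∞ := ne_top_of_le_ne_top ENNReal.ofReal_ne_top hG
    filter_upwards [hmid, hdeep', houter', eventually_pos_lt (show (0 : ℝ) < (δ / A) ^ 2 by positivity)] with t hmid_t hdeep_t houter_t ht
    have haδ : A * Real.sqrt t ≤ δ := mul_sqrt_le hA hδ.le ht.2.le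
    have hI := lintegral_hub_le_of_twoScale σ (hK t) hA ht.1 haδ G hdeep_t houter_t hmid_t
    exact ne_top_of_le_ne_top (ENNReal.add_ne_top.2 ⟨ENNReal.add_ne_top.2 ⟨hC₁, hC₂⟩, ENNReal.mul_ne_top hGfin ENNReal.ofReal_ne_top⟩) hI
  rw [tendsto_order]
  exact ⟨fun b hb => eventually_lt_div_log_of_twoScale σ K hfin hlower hb,
    fun b hb => eventually_div_log_lt_of_twoScale σ hK hgI hdeep houter hupper hb⟩

end Summit.QuantumFields.YangMills.Theorems.SwapVirialDeficit.BlowUp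

end
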